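import Summits.BirchSwinnertonDyer.Rank1Residual.Additive.TwistPartnerLevelOne
import HarnessLib

/-!
# The tame-branch measure of an ordinary twist partner at LEVEL ONE, tower currency: the rows
# (T0), (T1), (Tε) of `twistPartnerMeasure χ Φ ã (x 0) 1` on `ZMod (p^1)`
# (cell `b2b-bsdres`, sub-cell additive-p2 = X3♯(G-ord)/X4♯(G-ord), gen 25; sequel of
# `TwistPartnerLevelOne.lean`, which proves the three rows at level `p`)

HONEST FRAMING (cell `b2b-bsdres`, run/shared/lean/b2b/bsd-rank1-residual/, verbatim in every
file): the goal of the cell is to DELETE the COMBINATION-SHAPED residual classes of the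
Birch–Swinnerton-Dyer formula for ALL analytic-rank `≤ 1` elliptic curves over `ℚ` — "full BSD
formula for every rank `≤ 1` curve in class `C`" assembled STRICTLY from published theorems — so
that the rank-`≤ 1` remainder becomes exactly the CONSTRUCTION-SHAPED classes, which are TYPED
(missing-input `Prop`s), NOT attempted. This is not "finishing BSD". Sub-cell additive-p2: the
classes X3♯(G-ord) / X4♯(G-ord) are CONSTRUCTION-SHAPED and stay so; labels / RESIDUAL-MAP marks
UNCHANGED; nothing is booked. Theorems only; no definition, no named fact.

The finite-level currency of measures on the `p`-power tower is `μ : (n : ℕ) → ZMod (p^n) → _`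
(`twistPartnerMeasure`, and the named fact `Delbourgo1998.thm1_exists_bounded_evenMeasure`), so the
level-one rows of `TwistPartnerLevelOne.lean` (characters of `ℤ/p`) are transported along the
reduction `ℤ/p^1 → ℤ/p` (a bijection preserving representatives; characters, Jacobi sums and
twisted sums transported) and stated for characters `ψ` of level `p^1`, in EXACTLY the shape of the
fact's rows: (T0) `twistPartnerMeasure_level_one_one`, (T1) `twistPartnerMeasure_level_one_of_ne`
(`ψ ∉ {1, ε₁}`, Jacobi sum `J(ε₁, ψε₁⁻¹)`), (Tε) `twistPartnerMeasure_level_one_self` (the multiplier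
`(1 − ã⁻¹)(1 − ã/p)⁻¹`). No parity hypothesis. Nothing booked.

References: B. Mazur, J. Tate, J. Teitelbaum, Invent. Math. 84 (1986) §I.8, §I.10
[MazurTateTeitelbaum1986Invent]; D. Delbourgo, Compositio Math. 113 (1998) Thm. 1, p. 131
[Delbourgo1998].
-/

noncomputable section

open scoped Classical MatrixGroups ModularForm

open CongruenceSubgroup

namespace Summit.BirchSwinnertonDyer.Rank1Residual.Additive

open Literature.NumberTheory.EllipticCurves Literature.NumberTheory.EllipticCurves.ModularForms
  Literature.NumberTheory.EllipticCurves.Rank1Residual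

namespace TwistPartner

/-! ### §3 Transport to level `p^1` of the tower and the rows of `twistPartnerMeasure … 1` -/

section LevelOne

variable {p : ℕ} [hp : Fact p.Prime]

/-- The reduction `ℤ/p^1 → ℤ/p` is the representative map `b ↦ b.val`. [folklore] -/
theorem castHom_level_one_apply (b : ZMod (p ^ 1)) :
    ZMod.castHom (dvd_pow_self p one_ne_zero) (ZMod p) b = ((b.val : ℕ) : ZMod p) := by
  haveI : NeZero (p ^ 1) := ⟨pow_ne_zero _ hp.out.ne_zero⟩
  rw [ZMod.castHom_apply, ZMod.cast_eq_val]

/-- The representative is preserved: `(b mod p).val = b.val` for `b ∈ ℤ/p^1`. [folklore] -/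
theorem val_castHom_level_one (b : ZMod (p ^ 1)) :
    (ZMod.castHom (dvd_pow_self p one_ne_zero) (ZMod p) b).val = b.val := by
  rw [castHom_level_one_apply]
  exact ZMod.val_natCast_of_lt (by simpa using ZMod.val_lt b)

/-- The reduction `ℤ/p^1 → ℤ/p` is a bijection. [folklore] -/
theorem castHom_level_one_bijective :
    Function.Bijective (ZMod.castHom (dvd_pow_self p one_ne_zero) (ZMod p) : ZMod (p ^ 1) → ZMod p) := by
  haveI : NeZero (p ^ 1) := ⟨pow_ne_zero _ hp.out.ne_zero⟩
  have hinj : Function.Injective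
      (ZMod.castHom (dvd_pow_self p one_ne_zero) (ZMod p) : ZMod (p ^ 1) → ZMod p) := by
    intro b b' h
    have h' := congr_arg ZMod.val h
    rw [val_castHom_level_one, val_castHom_level_one] at h'
    exact ZMod.val_injective _ h'
  rw [Fintype.bijective_iff_injective_and_card]
  exact ⟨hinj, by simp [ZMod.card]⟩

/-- Sums over `ℤ/p^1` of a function of the reduction are sums over `ℤ/p`. [folklore] -/
theorem sum_castHom_level_one {M : Type*} [AddCommMonoid M] (F : ZMod p → M) :
    ∑ b : ZMod (p ^ 1), F (ZMod.castHom (dvd_pow_self p one_ne_zero) (ZMod p) b) =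
      ∑ c : ZMod p, F c :=
  Fintype.sum_bijective _ castHom_level_one_bijective _ _ fun _ ↦ rfl

/-- A character of `ℤ/p` lifted to level `p^1` is the character of the reduction (on ALL classes,
units or not). [folklore] -/
theorem changeLevel_level_one_apply {R : Type*} [CommRing R] (ψ : DirichletCharacter R p)
    (b : ZMod (p ^ 1)) :
    DirichletCharacter.changeLevel (dvd_pow_self p one_ne_zero) ψ b =
      ψ (ZMod.castHom (dvd_pow_self p one_ne_zero) (ZMod p) b) := by
  by_cases hb : IsUnit b
  · obtain ⟨u, rfl⟩ := hb
    rw [DirichletCharacter.changeLevel_eq_cast_of_dvd ψ (dvd_pow_self p one_ne_zero) u,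
      ZMod.castHom_apply]
  · have hb' : ¬ IsUnit (ZMod.castHom (dvd_pow_self p one_ne_zero) (ZMod p) b) := by
      rwa [← isUnit_iff_isUnit_cast (p := p) (m := 1) le_rfl b]
    rw [MulChar.map_nonunit _ hb, MulChar.map_nonunit _ hb']

omit hp in
/-- Every character at level `p^1` is lifted from level `p`. [folklore] -/
theorem exists_eq_changeLevel_level_one {R : Type*} [CommRing R]
    (ψ₁ : DirichletCharacter R (p ^ 1)) :
    ∃ ψ : DirichletCharacter R p, ψ₁ = DirichletCharacter.changeLevel (dvd_pow_self p one_ne_zero) ψ := by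
  refine ⟨DirichletCharacter.changeLevel (by rw [pow_one]) ψ₁, ?_⟩
  rw [← DirichletCharacter.changeLevel_trans]
  exact (DirichletCharacter.changeLevel_self ψ₁).symm

/-- Jacobi sums are transported along the lift `ℤ/p → ℤ/p^1`. [folklore] -/
theorem jacobiSum_changeLevel_level_one {R : Type*} [CommRing R] (ε φ : DirichletCharacter R p) :
    jacobiSum (DirichletCharacter.changeLevel (dvd_pow_self p one_ne_zero) ε)
        (DirichletCharacter.changeLevel (dvd_pow_self p one_ne_zero) φ) = jacobiSum ε φ := by
  unfold jacobiSum
  simp_rw [changeLevel_level_one_apply, map_sub, map_one]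
  exact sum_castHom_level_one (F := fun c ↦ ε c * φ (1 - c))

variable {χ : MulChar (ZMod p) ℚ_[p]} {Φ x : ℚ → ℚ_[p]} {ã : ℚ_[p]}

/-- The level-one value of the measure through the reduction:
`μ(b + pℤ_p) = ã⁻¹ · χ̄(b̄) · Φ(b̄.val/p)`. [folklore] -/
theorem twistPartnerMeasure_one_eq (χ : MulChar (ZMod p) ℚ_[p]) (Φ : ℚ → ℚ_[p]) (ã x₀ : ℚ_[p])
    (b : ZMod (p ^ 1)) :
    twistPartnerMeasure χ Φ ã x₀ 1 b =
      ã⁻¹ * χ⁻¹ (ZMod.castHom (dvd_pow_self p one_ne_zero) (ZMod p) b) *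
        Φ (((ZMod.castHom (dvd_pow_self p one_ne_zero) (ZMod p) b).val : ℚ) / p) := by
  rw [twistPartnerMeasure_succ]
  have h1 : ((p : ℚ) ^ (0 + 1)) = p := by rw [zero_add, pow_one]
  have h2 : ã⁻¹ ^ (0 + 1) = ã⁻¹ := by rw [zero_add, pow_one]
  rw [h1, h2, val_castHom_level_one, castHom_level_one_apply]

/-- The character sums at level `p^1` are the character sums at level `p`. [folklore] -/
theorem sum_changeLevel_mul_twistPartnerMeasure_one (χ : MulChar (ZMod p) ℚ_[p]) (Φ : ℚ → ℚ_[p])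
    (ã x₀ : ℚ_[p]) (ψ : DirichletCharacter ℂ_[p] p) :
    ∑ b : ZMod (p ^ 1), DirichletCharacter.changeLevel (dvd_pow_self p one_ne_zero) ψ b *
        algebraMap ℚ_[p] ℂ_[p] (twistPartnerMeasure χ Φ ã x₀ 1 b) =
      algebraMap ℚ_[p] ℂ_[p] ã⁻¹ *
        ∑ c : ZMod p, ψ c * algebraMap ℚ_[p] ℂ_[p] (χ⁻¹ c) *
          algebraMap ℚ_[p] ℂ_[p] (Φ ((c.val : ℚ) / p)) := by
  simp_rw [changeLevel_level_one_apply, twistPartnerMeasure_one_eq]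
  rw [sum_castHom_level_one (F := fun c ↦ ψ c *
    algebraMap ℚ_[p] ℂ_[p] (ã⁻¹ * χ⁻¹ c * Φ ((c.val : ℚ) / p))), Finset.mul_sum]
  exact Finset.sum_congr rfl fun c _ ↦ by rw [map_mul, map_mul]; ring

/-- The twisted sums of `x` at level `p^1` are those at level `p`. [folklore] -/
theorem sum_changeLevel_mul_apply_div_pow_one (x : ℚ → ℚ_[p]) (ψ : DirichletCharacter ℂ_[p] p) :
    ∑ b : ZMod (p ^ 1), DirichletCharacter.changeLevel (dvd_pow_self p one_ne_zero) ψ b *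
        algebraMap ℚ_[p] ℂ_[p] (x ((b.val : ℚ) / (p : ℚ) ^ 1)) =
      ∑ c : ZMod p, ψ c * algebraMap ℚ_[p] ℂ_[p] (x ((c.val : ℚ) / p)) := by
  simp_rw [changeLevel_level_one_apply, pow_one]
  have h : ∀ b : ZMod (p ^ 1), (b.val : ℚ) =
      ((ZMod.castHom (dvd_pow_self p one_ne_zero) (ZMod p) b).val : ℚ) := fun b ↦ by
    rw [val_castHom_level_one]
  simp_rw [h]
  exact sum_castHom_level_one (F := fun c ↦ ψ c * algebraMap ℚ_[p] ℂ_[p] (x ((c.val : ℚ) / p)))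

/-- **Row (T0) of the tame-branch measure**: `∑_b 𝟙(b) μ(b + pℤ_p) = ã⁻¹ · x(0)` at level `p^1`.
[cite: MazurTateTeitelbaum1986Invent, §I.10] -/
theorem twistPartnerMeasure_level_one_one (χ : MulChar (ZMod p) ℚ_[p]) (ã : ℚ_[p])
    (hx : ∀ s, x s = ∑ c : ZMod p, χ⁻¹ c * Φ (s + (c.val : ℚ) / p)) :
    ∑ b : ZMod (p ^ 1), (1 : DirichletCharacter ℂ_[p] (p ^ 1)) b *
        algebraMap ℚ_[p] ℂ_[p] (twistPartnerMeasure χ Φ ã (x 0) 1 b) =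
      algebraMap ℚ_[p] ℂ_[p] (ã⁻¹ * x 0) := by
  have h1 : (1 : DirichletCharacter ℂ_[p] (p ^ 1)) =
      DirichletCharacter.changeLevel (dvd_pow_self p one_ne_zero) (1 : DirichletCharacter ℂ_[p] p) :=
    (map_one _).symm
  rw [h1, sum_changeLevel_mul_twistPartnerMeasure_one, map_mul, ← sum_inv_mul_apply_div_eq hx]
  congr 1
  refine Finset.sum_congr rfl fun c _ ↦ ?_
  by_cases hc : IsUnit c
  · rw [MulChar.one_apply hc, one_mul]
  · rw [MulChar.map_nonunit _ hc, MulChar.map_nonunit _ hc, map_zero, zero_mul, zero_mul]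

/-- **Row (T1) of the tame-branch measure** at level `p^1`: for a character `ψ` of level `p^1` with
`ψ ∉ {1, ε₁}` (`ε₁` = the lift of `ι ∘ χ`),
`∑_b ψ(b) μ(b + pℤ_p) = ι(ã⁻¹ p⁻¹ χ(−1)) · J(ε₁, ψε₁⁻¹) · ∑_b ψ(b) ι x(b/p^1)`. No parity hypothesis.
[cite: MazurTateTeitelbaum1986Invent, §I.8, §I.10] [cite: Delbourgo1998, Theorem 1 (rows of conductor p)] -/
theorem twistPartnerMeasure_level_one_of_ne (hχ : χ ≠ 1) (hper : ∀ s, Φ (s + 1) = Φ s)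
    (hx : ∀ s, x s = ∑ c : ZMod p, χ⁻¹ c * Φ (s + (c.val : ℚ) / p))
    (hU : ∀ s, ∑ d : ZMod p, Φ (s + (d.val : ℚ) / p) = ã * Φ (p * s))
    (ψ : DirichletCharacter ℂ_[p] (p ^ 1)) (hψ1 : ψ ≠ 1)
    (hψε : ψ ≠ DirichletCharacter.changeLevel (dvd_pow_self p one_ne_zero)
      (χ.ringHomComp (algebraMap ℚ_[p] ℂ_[p]))) :
    ∑ b : ZMod (p ^ 1), ψ b * algebraMap ℚ_[p] ℂ_[p] (twistPartnerMeasure χ Φ ã (x 0) 1 b) =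
      algebraMap ℚ_[p] ℂ_[p] (ã⁻¹ * (p : ℚ_[p])⁻¹ * χ (-1)) *
        jacobiSum
          (DirichletCharacter.changeLevel (dvd_pow_self p one_ne_zero)
            (χ.ringHomComp (algebraMap ℚ_[p] ℂ_[p])))
          (ψ * (DirichletCharacter.changeLevel (dvd_pow_self p one_ne_zero)
            (χ.ringHomComp (algebraMap ℚ_[p] ℂ_[p])))⁻¹) *
        ∑ b : ZMod (p ^ 1), ψ b * algebraMap ℚ_[p] ℂ_[p] (x ((b.val : ℚ) / (p : ℚ) ^ 1)) := by
  haveI : NeZero (p ^ 1) := ⟨pow_ne_zero _ hp.out.ne_zero⟩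
  obtain ⟨ψ', rfl⟩ := exists_eq_changeLevel_level_one ψ
  have hψ1' : ψ' ≠ 1 := fun h ↦ hψ1 (by rw [h, map_one])
  have hψε' : ψ' ≠ χ.ringHomComp (algebraMap ℚ_[p] ℂ_[p]) := fun h ↦ hψε (by rw [h])
  rw [sum_changeLevel_mul_twistPartnerMeasure_one, sum_changeLevel_mul_apply_div_pow_one,
    ← map_inv, ← map_mul, jacobiSum_changeLevel_level_one,
    sum_mul_inv_mul_apply_div_eq hχ hper hx hU hψ1' hψε']
  simp only [map_mul, map_div₀, map_inv₀, map_natCast]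
  ring

/-- **Row (Tε) of the tame-branch measure** at level `p^1`: for `ε₁` the lift of `ι ∘ χ`,
`∑_b ε₁(b) μ(b + pℤ_p) = ι((1 − ã⁻¹)(1 − ã/p)⁻¹ p⁻¹ χ(−1)) · ∑_b ε₁(b) ι x(b/p^1)` — the row with
Delbourgo's multiplier `L^{(G)}_p(1) = (1 − α_p⁻¹)(1 − α_p/p)⁻¹`. No parity hypothesis.
[cite: Delbourgo1998, Theorem 1 and the multiplier L^{(G)}_p (p. 131)] -/
theorem twistPartnerMeasure_level_one_self (hχ : χ ≠ 1) (hã : ‖ã‖ = 1)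
    (hper : ∀ s, Φ (s + 1) = Φ s)
    (hx : ∀ s, x s = ∑ c : ZMod p, χ⁻¹ c * Φ (s + (c.val : ℚ) / p))
    (hU : ∀ s, ∑ d : ZMod p, Φ (s + (d.val : ℚ) / p) = ã * Φ (p * s)) :
    ∑ b : ZMod (p ^ 1),
        DirichletCharacter.changeLevel (dvd_pow_self p one_ne_zero)
          (χ.ringHomComp (algebraMap ℚ_[p] ℂ_[p])) b *
          algebraMap ℚ_[p] ℂ_[p] (twistPartnerMeasure χ Φ ã (x 0) 1 b) =
      algebraMap ℚ_[p] ℂ_[p] ((1 - ã⁻¹) * (1 - ã / p)⁻¹ * (p : ℚ_[p])⁻¹ * χ (-1)) *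
        ∑ b : ZMod (p ^ 1),
          DirichletCharacter.changeLevel (dvd_pow_self p one_ne_zero)
            (χ.ringHomComp (algebraMap ℚ_[p] ℂ_[p])) b *
            algebraMap ℚ_[p] ℂ_[p] (x ((b.val : ℚ) / (p : ℚ) ^ 1)) := by
  have hã0 : ã ≠ 0 := fun h0 ↦ by rw [h0, norm_zero] at hã; exact zero_ne_one hã
  rw [sum_changeLevel_mul_twistPartnerMeasure_one, sum_changeLevel_mul_apply_div_pow_one]
  have happ : ∀ c : ZMod p, (χ.ringHomComp (algebraMap ℚ_[p] ℂ_[p])) c =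
      algebraMap ℚ_[p] ℂ_[p] (χ c) := fun c ↦ rfl
  simp_rw [happ]
  rw [sum_self_mul_inv_mul_apply_div_eq hχ hã hper hx hU, ← mul_assoc, ← map_mul]
  congr 2
  field_simp

end LevelOne

end TwistPartner

end Summit.BirchSwinnertonDyer.Rank1Residual.Additive

end
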